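import Summits.QuantumFields.YangMills.Theorems.VirialFluxGapSharpTwistedLaplaceLogAssembly
import Summits.QuantumFields.YangMills.Theorems.VirialFluxGapDeficitForm
import Summits.QuantumFields.YangMills.Theses.VirialFluxGap
import HarnessLib

/-!
# ⟨stmt-QuantumFields-24204⟩ `SharpTwistedLaplace` FROM per-`L` tube asymptotics with polynomial constants — the assembly, proved
# (layer (D) of the DIRECT Laplace road; fixes the interface the remaining stubs must deliver)

Helper module (free-hands work of width seat ym-line-sfw-p2-w2 g49, cell ym-idea-1).
* ★ `log_asymptotic_of_tubeAsymptotics` (pure real analysis) — if for every `L ≥ L₁` and `z ≠ 0` a positive quantity `I(β, L, z)` satisfies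
  the TUBE ASYMPTOTIC `|I − Σ_a c_a (2π/β)^{9L⁴}| ≤ Σ_a (K_a/β) c_a (2π/β)^{9L⁴} + e^{−βη}` for `β ≥ 1` (literally the output of
  ✓`laplaceMethod_quantitative_sum_of_tubes` fed with ✓`laplaceMethod_quantitative_orbit_tube` and an off-tube floor `η`), with constants
  POLYNOMIAL in `L` — `K_a ≤ A L^p`, `|log Σ_a c_a| ≤ A L^p`, `η ≥ 1/(A L^p)` — and `logSW = 12βL⁴ + log I`, then the conclusion of
  `SharpTwistedLaplace` holds in the window `L ≤ β^a`, `a = 1/(8(p+4))`, with `K = 2A + 2`, `q = p`, `C(L,z) = log Σ_a c_a(L,z) + 9L⁴ log 2π`,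
  `β₀ = (A² + 42A + 2)⁸`, `L₀ = max L₁ 1` (all explicit);
* ★★ `sharpTwistedLaplace_of_tubeAsymptotics` — the same with `I = ∫ e^{−βF_z} d(ringMeasure L)` and `logSW = log sectorWeight` (✓`RingDeficit.deficitForm`):
  the crux ⟨24204⟩ `Summit.QuantumFields.YangMills.Theses.VirialFluxGap.SharpTwistedLaplace` BY NAME from the tube asymptotics of the ring integral.
So what the planner's stubs {orbitChart, windowData} must deliver is EXACTLY hypothesis `hI` below (memo `DIRECT-LAPLACE-24204-v5.md` §9).
Everything is PROVED; no definitions, no named facts, no sorry.  HONEST FRAMING: this is a CONDITIONAL assembly (the tube asymptotics are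
its hypothesis, not proved here); ⟨24204⟩, ⟨24319⟩ and every rung stay OPEN; the Yang–Mills mass gap (Clay) is NOT touched; no summit is
proved by a line.
-/

noncomputable section

open Real Finset MeasureTheory
open scoped BigOperators

namespace Summit.QuantumFields.YangMills.Theorems.QuantitativeLaplace

/-! ## §1 Window arithmetic -/

/-- In the window `1 ≤ L ≤ β^a`, `a = 1/(8(p+4))`, `β ≥ 1`: `L^p ≤ β^{1/8}` and `L⁴ ≤ β^{1/8}`. [folklore] -/
theorem pow_le_rpow_eighth_of_window {β : ℝ} {L p : ℕ} (hβ : 1 ≤ β) (hL : (L : ℝ) ≤ β ^ (1 / (8 * ((p : ℝ) + 4)))) :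
    (L : ℝ) ^ p ≤ β ^ (1 / 8 : ℝ) ∧ (L : ℝ) ^ 4 ≤ β ^ (1 / 8 : ℝ) := by
  have hβ0 : 0 ≤ β := by linarith
  have hp0 : (0 : ℝ) ≤ p := Nat.cast_nonneg p
  have ha0 : 0 ≤ 1 / (8 * ((p : ℝ) + 4)) := by positivity
  have hL0 : (0 : ℝ) ≤ L := Nat.cast_nonneg L
  have h1 : (L : ℝ) ^ p ≤ β ^ (1 / (8 * ((p : ℝ) + 4)) * p) := by
    rw [Real.rpow_mul hβ0, Real.rpow_natCast]
    exact pow_le_pow_left₀ hL0 hL p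
  have h2 : (L : ℝ) ^ 4 ≤ β ^ (1 / (8 * ((p : ℝ) + 4)) * 4) := by
    rw [Real.rpow_mul hβ0, show ((4 : ℝ)) = ((4 : ℕ) : ℝ) by norm_num, Real.rpow_natCast]
    exact pow_le_pow_left₀ hL0 hL 4
  have e1 : 1 / (8 * ((p : ℝ) + 4)) * p ≤ 1 / 8 := by
    rw [div_mul_eq_mul_div, one_mul, div_le_div_iff₀ (by positivity) (by norm_num)]
    nlinarith
  have e2 : 1 / (8 * ((p : ℝ) + 4)) * 4 ≤ 1 / 8 := by
    rw [div_mul_eq_mul_div, one_mul, div_le_div_iff₀ (by positivity) (by norm_num)]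
    nlinarith
  exact ⟨h1.trans (Real.rpow_le_rpow_of_exponent_le hβ e1), h2.trans (Real.rpow_le_rpow_of_exponent_le hβ e2)⟩

/-- Powers of `s = β^{1/8}`: `s⁸ = β`, `s² = β^{1/4}`, and `β ≥ B⁸ ⇒ s ≥ B`. [folklore] -/
theorem rpow_eighth_facts {β B : ℝ} (hB : 0 ≤ B) (hβ : B ^ 8 ≤ β) (hβ0 : 0 ≤ β) :
    (β ^ (1 / 8 : ℝ)) ^ 8 = β ∧ (β ^ (1 / 8 : ℝ)) ^ 2 = β ^ (1 / 4 : ℝ) ∧ B ≤ β ^ (1 / 8 : ℝ) := by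
  refine ⟨?_, ?_, ?_⟩
  · rw [← Real.rpow_natCast, ← Real.rpow_mul hβ0]; norm_num
  · rw [← Real.rpow_natCast, ← Real.rpow_mul hβ0]; norm_num
  · have h := Real.rpow_le_rpow (by positivity) hβ (by norm_num : (0 : ℝ) ≤ 1 / 8)
    rwa [show (1 / 8 : ℝ) = ((8 : ℕ) : ℝ)⁻¹ by norm_num, Real.pow_rpow_inv_natCast hB (by norm_num),
      show ((8 : ℕ) : ℝ)⁻¹ = (1 / 8 : ℝ) by norm_num] at h

/-! ## §2 Window arithmetic in the variable `s = β^{1/8}` -/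

/-- Smallness `(K_max+1)/β ≤ 1/2` in the window: `2(Ax + 1) ≤ s⁸` for `x ≤ s`, `2(A+1) ≤ s`. [folklore] -/
theorem window_arith_small {A s x : ℝ} (hA : 1 ≤ A) (hs : 2 * (A + 1) ≤ s) (hxs : x ≤ s) :
    2 * (A * x + 1) ≤ s ^ 8 := by
  have hs1 : 1 ≤ s := by linarith
  have h1 : A * x + 1 ≤ (A + 1) * s := by nlinarith
  have h2 : 2 * ((A + 1) * s) ≤ s ^ 2 := by nlinarith
  have h3 : s ^ 2 ≤ s ^ 8 := pow_le_pow_right₀ hs1 (by norm_num)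
  linarith

/-- The window condition in the variable `s`: `A s + 40 s³ ≤ s⁷/A` once `A² + 40A ≤ s`. [folklore] -/
theorem window_arith_main {A s : ℝ} (hA : 1 ≤ A) (hs : A ^ 2 + 40 * A ≤ s) : A * s + 40 * s ^ 3 ≤ s ^ 7 / A := by
  have hA0 : 0 < A := by linarith
  have hs1 : 1 ≤ s := by nlinarith
  rw [le_div_iff₀ hA0]
  have hs3 : 1 ≤ s ^ 3 := one_le_pow₀ hs1
  have hs4 : A ^ 2 + 40 * A ≤ s ^ 4 := by
    calc A ^ 2 + 40 * A ≤ s := hs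
      _ ≤ s ^ 4 := le_self_pow₀ hs1 (by norm_num)
  have hss : s ≤ s ^ 3 := le_self_pow₀ hs1 (by norm_num)
  have key : (A * s + 40 * s ^ 3) * A ≤ (A ^ 2 + 40 * A) * s ^ 3 := by
    nlinarith [mul_le_mul_of_nonneg_left hss (sq_nonneg A)]
  calc (A * s + 40 * s ^ 3) * A ≤ (A ^ 2 + 40 * A) * s ^ 3 := key
    _ ≤ s ^ 4 * s ^ 3 := mul_le_mul_of_nonneg_right hs4 (by positivity)
    _ = s ^ 7 := by ring

/-! ## §3 The abstract assembly -/

/-- ★ **`SharpTwistedLaplace`-shaped conclusion from per-`L` tube asymptotics with polynomial constants** (pure real analysis; all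
constants explicit: `K = 2A+2`, `q = p`, `C(L,z) = log Σ_a c_a + 9L⁴ log 2π`, `a = 1/(8(p+4))`, `β₀ = (A²+42A+2)⁸`, `L₀ = max L₁ 1`).
[cite: Breitung1994, Thm 41 p. 56; Thm 56 (6.31)] -/
theorem log_asymptotic_of_tubeAsymptotics {ι : Type*} [Fintype ι] [Nonempty ι]
    {logSW I : ℝ → ℕ → (Fin 3 → Bool) → ℝ} {c K : ℕ → (Fin 3 → Bool) → ι → ℝ} {η : ℕ → (Fin 3 → Bool) → ℝ}
    {A : ℝ} {p L₁ : ℕ} (hA : 1 ≤ A)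
    (hSW : ∀ (β : ℝ) (L : ℕ) (z : Fin 3 → Bool), 1 ≤ β → L₁ ≤ L → z ≠ (fun _ => false) →
      logSW β L z = 12 * β * (L : ℝ) ^ 4 + Real.log (I β L z))
    (hc : ∀ (L : ℕ) (z : Fin 3 → Bool) (a : ι), L₁ ≤ L → z ≠ (fun _ => false) → 0 < c L z a)
    (hK : ∀ (L : ℕ) (z : Fin 3 → Bool) (a : ι), L₁ ≤ L → z ≠ (fun _ => false) → K L z a ≤ A * (L : ℝ) ^ p)
    (hΛ : ∀ (L : ℕ) (z : Fin 3 → Bool), L₁ ≤ L → z ≠ (fun _ => false) → |Real.log (∑ a, c L z a)| ≤ A * (L : ℝ) ^ p)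
    (hη : ∀ (L : ℕ) (z : Fin 3 → Bool), L₁ ≤ L → z ≠ (fun _ => false) → 1 / (A * (L : ℝ) ^ p) ≤ η L z)
    (hI : ∀ (β : ℝ) (L : ℕ) (z : Fin 3 → Bool), 1 ≤ β → L₁ ≤ L → z ≠ (fun _ => false) →
      |I β L z - ∑ a, c L z a * (2 * π / β) ^ ((9 : ℝ) * (L : ℝ) ^ 4)| ≤
        (∑ a, K L z a / β * (c L z a * (2 * π / β) ^ ((9 : ℝ) * (L : ℝ) ^ 4))) + Real.exp (-(β * η L z))) :
    ∃ K' : ℝ, ∃ q : ℝ, ∃ C : ℕ → (Fin 3 → Bool) → ℝ, ∃ a : ℝ, 0 < a ∧ ∃ β₀ : ℝ, ∃ L₀ : ℕ, ∀ β : ℝ, β₀ ≤ β →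
      ∀ L : ℕ, L₀ ≤ L → (L : ℝ) ≤ β ^ a → ∀ z : Fin 3 → Bool, z ≠ (fun _ => false) →
        |logSW β L z - (12 * β * (L : ℝ) ^ 4 - 9 * (L : ℝ) ^ 4 * Real.log β + C L z)| ≤ K' * (L : ℝ) ^ q / β := by
  have hB1 : 1 ≤ A ^ 2 + 42 * A + 2 := by nlinarith
  have ha : 0 < 1 / (8 * ((p : ℝ) + 4)) := by positivity
  refine ⟨2 * A + 2, p, fun L z => Real.log (∑ a, c L z a) + 9 * (L : ℝ) ^ 4 * Real.log (2 * π),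
    1 / (8 * ((p : ℝ) + 4)), ha, (A ^ 2 + 42 * A + 2) ^ 8, max L₁ 1, ?_⟩
  intro β hβ L hL hLβ z hz
  have hL₁ : L₁ ≤ L := le_of_max_le_left hL
  have hL1r : (1 : ℝ) ≤ L := by exact_mod_cast le_of_max_le_right hL
  have hβ1 : 1 ≤ β := le_trans (one_le_pow₀ hB1) hβ
  have hβ0 : 0 < β := by linarith
  -- `s = β^{1/8}` and the window consequences
  obtain ⟨hs8, hs2, hsB⟩ := rpow_eighth_facts (by linarith) hβ hβ0.le
  obtain ⟨hLp, hL4⟩ := pow_le_rpow_eighth_of_window (p := p) hβ1 hLβ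
  obtain ⟨s, hsdef⟩ : ∃ s : ℝ, β ^ (1 / 8 : ℝ) = s := ⟨_, rfl⟩
  rw [hsdef] at hs8 hs2 hsB hLp hL4
  have hs1 : 1 ≤ s := hB1.trans hsB
  have hLp1 : 1 ≤ (L : ℝ) ^ p := one_le_pow₀ hL1r
  have hA0 : 0 < A := by linarith
  have hApos : 0 < A * (L : ℝ) ^ p := by positivity
  have hlogβ0 : 0 ≤ Real.log β := Real.log_nonneg hβ1
  have hlogβ : Real.log β ≤ 4 * s ^ 2 := by
    have h := Real.log_le_rpow_div hβ0.le (by norm_num : (0 : ℝ) < 1 / 4)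
    rw [← hs2] at h
    linarith
  -- data at (L, z)
  have hc' : ∀ a, 0 < c L z a := fun a => hc L z a hL₁ hz
  have hK' : ∀ a, K L z a ≤ A * (L : ℝ) ^ p := fun a => hK L z a hL₁ hz
  have hΛ' := hΛ L z hL₁ hz
  have hη' := hη L z hL₁ hz
  have hΛpos : 0 < ∑ a, c L z a := Finset.sum_pos (fun a _ => hc' a) Finset.univ_nonempty
  -- (i) smallness `(K_max + 1)/β ≤ 1/2`
  have hsmall : (A * (L : ℝ) ^ p + 1) / β ≤ 1 / 2 := by
    have h := window_arith_small hA (by nlinarith) hLp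
    rw [hs8] at h
    rw [div_le_iff₀ hβ0]
    linarith
  -- (ii) the window condition for `M = 1`
  have hwin : Real.log 1 - Real.log (∑ a, c L z a) - (9 : ℝ) * (L : ℝ) ^ 4 * Real.log (2 * π) +
      ((9 : ℝ) * (L : ℝ) ^ 4 + 1) * Real.log β ≤ β * η L z := by
    have h2π : 0 ≤ Real.log (2 * π) := Real.log_nonneg (by linarith [Real.pi_gt_three])
    have hneg : -Real.log (∑ a, c L z a) ≤ A * s := by
      have h1 := neg_abs_le (Real.log (∑ a, c L z a))
      have h2 : A * (L : ℝ) ^ p ≤ A * s := mul_le_mul_of_nonneg_left hLp hA0.le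
      linarith
    have h9 : 0 ≤ (9 : ℝ) * (L : ℝ) ^ 4 * Real.log (2 * π) := by positivity
    have hL4' : (9 : ℝ) * (L : ℝ) ^ 4 + 1 ≤ 10 * s := by linarith
    have hlog' : ((9 : ℝ) * (L : ℝ) ^ 4 + 1) * Real.log β ≤ 10 * s * (4 * s ^ 2) :=
      mul_le_mul hL4' hlogβ hlogβ0 (by positivity)
    have hlhs : Real.log 1 - Real.log (∑ a, c L z a) - (9 : ℝ) * (L : ℝ) ^ 4 * Real.log (2 * π) +
        ((9 : ℝ) * (L : ℝ) ^ 4 + 1) * Real.log β ≤ A * s + 40 * s ^ 3 := by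
      rw [Real.log_one]
      have e : 10 * s * (4 * s ^ 2) = 40 * s ^ 3 := by ring
      linarith
    have hmid : A * s + 40 * s ^ 3 ≤ s ^ 7 / A := window_arith_main hA (by nlinarith)
    -- `s⁷/A ≤ β/(A L^p) ≤ β η`
    have hrhs1 : s ^ 7 / A ≤ β * (1 / (A * (L : ℝ) ^ p)) := by
      rw [mul_one_div, div_le_div_iff₀ hA0 hApos, ← hs8]
      have h1 : (L : ℝ) ^ p * s ^ 7 ≤ s * s ^ 7 := mul_le_mul_of_nonneg_right hLp (by positivity)
      have e1 : s ^ 7 * (A * (L : ℝ) ^ p) = A * ((L : ℝ) ^ p * s ^ 7) := by ring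
      have e2 : s ^ 8 * A = A * (s * s ^ 7) := by ring
      rw [e1, e2]
      exact mul_le_mul_of_nonneg_left h1 hA0.le
    have hrhs2 : β * (1 / (A * (L : ℝ) ^ p)) ≤ β * η L z := mul_le_mul_of_nonneg_left hη' hβ0.le
    linarith
  have hM : Real.exp (-(β * η L z)) ≤ 1 / β * ((∑ a, c L z a) * (2 * π / β) ^ ((9 : ℝ) * (L : ℝ) ^ 4)) := by
    have h := mul_exp_neg_le_main_div (M := 1) (η := η L z) (Λ := ∑ a, c L z a) (d := (9 : ℝ) * (L : ℝ) ^ 4)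
      one_pos hΛpos hβ0 hwin
    rwa [one_mul] at h
  -- the log-form assembly
  obtain ⟨-, hlog⟩ := abs_log_sub_asymptotic_le_of_sum_of_tubes (ι := ι) (c := c L z) (K := K L z)
    (Itot := I β L z) (Mρ := Real.exp (-(β * η L z))) (Kmax := A * (L : ℝ) ^ p) (d := (9 : ℝ) * (L : ℝ) ^ 4)
    hβ0 hc' hK' (hI β L z hβ1 hL₁ hz) hM hsmall
  rw [hSW β L z hβ1 hL₁ hz, Real.rpow_natCast]
  have e : 12 * β * (L : ℝ) ^ 4 + Real.log (I β L z) -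
      (12 * β * (L : ℝ) ^ 4 - 9 * (L : ℝ) ^ 4 * Real.log β + (Real.log (∑ a, c L z a) + 9 * (L : ℝ) ^ 4 * Real.log (2 * π))) =
      Real.log (I β L z) - (Real.log (∑ a, c L z a) + (9 : ℝ) * (L : ℝ) ^ 4 * Real.log (2 * π) -
        (9 : ℝ) * (L : ℝ) ^ 4 * Real.log β) := by ring
  rw [e]
  have hfin : 2 * (A * (L : ℝ) ^ p + 1) ≤ (2 * A + 2) * (L : ℝ) ^ p := by nlinarith
  exact hlog.trans (div_le_div_of_nonneg_right hfin hβ0.le)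

/-! ## §4 The crux by name from tube asymptotics of the ring integral -/

/-- ★★ **⟨stmt-QuantumFields-24204⟩ `SharpTwistedLaplace` from tube asymptotics of the ring integral `∫ e^{−βF_z} d(ringMeasure L)`**
with polynomial constants (✓`RingDeficit.deficitForm` supplies `log sectorWeight = 12βL⁴ + log ∫ e^{−βF_z}`).  CONDITIONAL assembly:
hypothesis `hI` is what the chart∕window stubs must prove. [cite: Luscher1983, §2] [cite: Breitung1994, Thm 41 p. 56] -/
theorem sharpTwistedLaplace_of_tubeAsymptotics {ι : Type*} [Fintype ι] [Nonempty ι]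
    {c K : ℕ → (Fin 3 → Bool) → ι → ℝ} {η : ℕ → (Fin 3 → Bool) → ℝ} {A : ℝ} {p L₁ : ℕ} (hA : 1 ≤ A)
    (hc : ∀ (L : ℕ) (z : Fin 3 → Bool) (a : ι), L₁ ≤ L → z ≠ (fun _ => false) → 0 < c L z a)
    (hK : ∀ (L : ℕ) (z : Fin 3 → Bool) (a : ι), L₁ ≤ L → z ≠ (fun _ => false) → K L z a ≤ A * (L : ℝ) ^ p)
    (hΛ : ∀ (L : ℕ) (z : Fin 3 → Bool), L₁ ≤ L → z ≠ (fun _ => false) → |Real.log (∑ a, c L z a)| ≤ A * (L : ℝ) ^ p)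
    (hη : ∀ (L : ℕ) (z : Fin 3 → Bool), L₁ ≤ L → z ≠ (fun _ => false) → 1 / (A * (L : ℝ) ^ p) ≤ η L z)
    (hI : ∀ (β : ℝ) (L : ℕ) [NeZero L] (z : Fin 3 → Bool), 1 ≤ β → L₁ ≤ L → z ≠ (fun _ => false) →
      |(∫ P, Real.exp (-(β * VirialFluxGap.RingDeficit.ringDeficit L z P)) ∂(VirialFluxGap.RingDeficit.ringMeasure L)) -
          ∑ a, c L z a * (2 * π / β) ^ ((9 : ℝ) * (L : ℝ) ^ 4)| ≤
        (∑ a, K L z a / β * (c L z a * (2 * π / β) ^ ((9 : ℝ) * (L : ℝ) ^ 4))) + Real.exp (-(β * η L z))) :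
    Summit.QuantumFields.YangMills.Theses.VirialFluxGap.SharpTwistedLaplace := by
  classical
  -- the two quantities as total functions of `L : ℕ` (value irrelevant at `L = 0`)
  let logSW : ℝ → ℕ → (Fin 3 → Bool) → ℝ := fun β L z =>
    if h : L = 0 then 0 else
      haveI : NeZero L := ⟨h⟩
      Real.log (Summit.QuantumFields.YangMills.Theorems.FemtoTransferGap.TT.sectorWeight (L := L) β (2 * L - 1) z
        (fun _ _ => (1 : ℝ)))
  let I : ℝ → ℕ → (Fin 3 → Bool) → ℝ := fun β L z =>
    if h : L = 0 then 0 else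
      haveI : NeZero L := ⟨h⟩
      ∫ P, Real.exp (-(β * VirialFluxGap.RingDeficit.ringDeficit L z P)) ∂(VirialFluxGap.RingDeficit.ringMeasure L)
  have hSW : ∀ (β : ℝ) (L : ℕ) (z : Fin 3 → Bool), 1 ≤ β → max L₁ 1 ≤ L → z ≠ (fun _ => false) →
      logSW β L z = 12 * β * (L : ℝ) ^ 4 + Real.log (I β L z) := by
    intro β L z _ hL _
    have hL0 : L ≠ 0 := by have := le_of_max_le_right hL; omega
    simp only [logSW, I, dif_neg hL0]
    haveI : NeZero L := ⟨hL0⟩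
    exact (VirialFluxGap.RingDeficit.deficitForm L z).2.2 β
  have hI' : ∀ (β : ℝ) (L : ℕ) (z : Fin 3 → Bool), 1 ≤ β → max L₁ 1 ≤ L → z ≠ (fun _ => false) →
      |I β L z - ∑ a, c L z a * (2 * π / β) ^ ((9 : ℝ) * (L : ℝ) ^ 4)| ≤
        (∑ a, K L z a / β * (c L z a * (2 * π / β) ^ ((9 : ℝ) * (L : ℝ) ^ 4))) + Real.exp (-(β * η L z)) := by
    intro β L z hβ hL hz
    have hL0 : L ≠ 0 := by have := le_of_max_le_right hL; omega
    simp only [I, dif_neg hL0]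
    haveI : NeZero L := ⟨hL0⟩
    exact hI β L z hβ (le_of_max_le_left hL) hz
  obtain ⟨K', q, C, a, ha, β₀, L₀, h⟩ := log_asymptotic_of_tubeAsymptotics (ι := ι) (logSW := logSW) (I := I)
    (L₁ := max L₁ 1) hA hSW
    (fun L z a hL hz => hc L z a (le_of_max_le_left hL) hz) (fun L z a hL hz => hK L z a (le_of_max_le_left hL) hz)
    (fun L z hL hz => hΛ L z (le_of_max_le_left hL) hz) (fun L z hL hz => hη L z (le_of_max_le_left hL) hz) hI'
  refine ⟨K', q, C, a, ha, β₀, max L₀ 1, fun β hβ L _ hL hLβ z hz => ?_⟩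
  have hL0 : L ≠ 0 := by have := le_of_max_le_right hL; omega
  have h' := h β hβ L (le_of_max_le_left hL) hLβ z hz
  simp only [logSW, dif_neg hL0] at h'
  exact h'

end Summit.QuantumFields.YangMills.Theorems.QuantitativeLaplace
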